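import Summits.CriticalPhenomena.PercolationContinuityZ3.Theorems.PercNearOneGluingNoHeavyLowerTailIncStarRootPairTransfer
import Summits.CriticalPhenomena.PercolationContinuityZ3.Theorems.PercNearOneGluingNoHeavyLowerTailIncStarRootPairForest
import HarnessLib

/-!
# Root-pair concavity on apex-forests, II: `E₃` is concave along EVERY root pair (FC, cases (a), (b), (c))

Support file for the Sahi programme (`--supports stmt-CriticalPhenomena-4575`, prover prim-sahi-p2 gen 20).  No definitions, no named
facts, no sorries; standard axioms.  Memo `run/shared/lean/prim/prim-sahi/prim-sahi-p2/PROOF-E3.md` §30; lead g120 §8 (CONJECTURE FC of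
p2 gen 18: on an apex-forest, `E₃` of the increasing star is concave along every pair).

**Theorem `incStar_rootPair_concave_of_apexForest`.**  Let `w` be an apex-forest weight for the root `s` (the non-root pairs of positive
weight form a forest `H(w)`), `x ≠ s`, and `a, b, c` arbitrary targets (coincidences, targets at the root or at `x` allowed).  Then the cubic
`q ↦ E₃(w[s(s,x)↦q])`, `E₃ = E₃({s↔a},{s↔b},{s↔c})`, is CONCAVE on `[0,1]`: for `0 ≤ p₀ ≤ p ≤ p₁ ≤ 1`,
`(p₁ − p)·E₃(w[e↦p₀]) + (p − p₀)·E₃(w[e↦p₁]) ≤ (p₁ − p₀)·E₃(w[e↦p])`.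
Together with THEOREM B (`IncStar.incStar_bridge_chord`: chords along 1|2 environment bridges) this settles the root-pair half of FC, i.e.
FC's cases (a) separating vertex, (b) target, (c) non-separating non-target — the last one being the case that needs a genuine REDUCTION.

**Proof.**  A target at the root: `E₃ = Cov` of the other two (`incStar_rootSlot_threePoint`).  Otherwise strong induction on the number of
environment pairs.  Let `T` be the tree of `x` in `H(w)`.  (far) No target in `T`: `E₃` does not depend on the root pair
(`incStar_rootPair_eq_of_far`).  (B′) If some set `L ∌ s, x` closed off from `{y ∉ L, y ≠ s, x}` (a union of branches of `T` at `x`, or the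
complement of `T`) holds exactly one target slot in `insert x L` and the other two outside `L`, THEOREM B′-forest in three-point form
(`rootPair_threePoint_of_apexForest`: `Ψ ≥ 0` + branch lemma) applies; this covers: a target at `x`; one or two targets outside `T`; and all
three in `T ∖ {x}` unless they lie in ONE branch `B` at `x` (through the neighbour `y`).  (c-ii) In that last case the other branches at `x`
together with `x` form a blob with terminals `s, y`: by the blob reparametrisation (`incStar_rootPair_blob_transfer`) `E₃(w[s(s,x)↦q]) =
E₃(W[s(s,y)↦r(q)])` with `r` affine non-decreasing and `W` an apex-forest weight with fewer environment pairs (the pair `s(x,y)` is gone);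
the induction hypothesis at the root pair `s(s,y)` of `W` transfers (`threePoint_transfer_real`).  ∎
-/

noncomputable section

namespace Summit.CriticalPhenomena.PercolationContinuityZ3.Theorems

namespace IncStar

open MeasureTheory Set Literature.Probability.Percolation Literature.Probability.LatticeModels
open scoped Classical

variable {n : ℕ}

/-- **First step of a path**: if `a ≠ x` is reachable from `x`, some neighbour `y` of `x` reaches `a` avoiding the edge `s(x,y)`. [folklore] -/
theorem reachable_firstStep {G : SimpleGraph (Fin n)} {x a : Fin n} (h : G.Reachable x a) (hax : a ≠ x) :
    ∃ y : Fin n, G.Adj x y ∧ (G.deleteEdges {s(x, y)}).Reachable y a := by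
  obtain ⟨p⟩ := h
  have key : ∀ q : G.Walk x a, q.IsPath → ∃ y : Fin n, G.Adj x y ∧ (G.deleteEdges {s(x, y)}).Reachable y a := by
    intro q hq
    cases q with
    | nil => exact absurd rfl hax
    | cons hadj r =>
      rename_i y
      have hxr : x ∉ r.support := ((SimpleGraph.Walk.cons_isPath_iff hadj r).1 hq).2
      exact ⟨y, hadj, SimpleGraph.reachable_deleteEdges_iff_exists_walk.2
        ⟨r, fun he => hxr (r.fst_mem_support_of_mem_edges he)⟩⟩
  exact key p.bypass p.bypass_isPath

/-- **`E₃` of the increasing star is concave along every root pair of every apex-forest** (three-point form; FC cases (a), (b), (c)).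
[this work] -/
theorem incStar_rootPair_concave_of_apexForest (w : Sym2 (Fin n) → unitInterval) (s x a b c : Fin n) (hxs : x ≠ s)
    (hforest : (SimpleGraph.fromEdgeSet {z : Sym2 (Fin n) | s ∉ z ∧ w z ≠ 0}).IsAcyclic)
    (p₀ p p₁ : unitInterval) (h01 : p₀ ≤ p) (h12 : p ≤ p₁) :
    ((p₁ : ℝ) - (p : ℝ)) * sahiE3 (prodBernoulli (Function.update w s(s, x) p₀)) (openConn s a) (openConn s b) (openConn s c)
      + ((p : ℝ) - (p₀ : ℝ)) * sahiE3 (prodBernoulli (Function.update w s(s, x) p₁)) (openConn s a) (openConn s b) (openConn s c)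
    ≤ ((p₁ : ℝ) - (p₀ : ℝ)) * sahiE3 (prodBernoulli (Function.update w s(s, x) p)) (openConn s a) (openConn s b) (openConn s c) := by
  -- targets at the root: `E₃ = Cov` of the other two, concave along every pair
  by_cases has : a = s
  · subst has; exact incStar_rootSlot_threePoint w _ a b c p₀ p p₁ h01 h12
  by_cases hbs : b = s
  · subst hbs
    have h := incStar_rootSlot_threePoint w s(b, x) b a c p₀ p p₁ h01 h12
    simp only [sahiE3_comm₁₂ _ (openConn b b) (openConn b a) (openConn b c)] at h
    exact h
  by_cases hcs : c = s
  · subst hcs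
    have h := incStar_rootSlot_threePoint w s(c, x) c a b p₀ p p₁ h01 h12
    simp only [sahiE3_comm₁₂ _ (openConn c c) (openConn c a) (openConn c b),
      sahiE3_comm₂₃ _ (openConn c a) (openConn c c) (openConn c b)] at h
    exact h
  -- strong induction on the number of environment pairs, over all weights, vertices and targets off the root
  suffices H : ∀ (N : ℕ) (w : Sym2 (Fin n) → unitInterval) (x a b c : Fin n), x ≠ s → a ≠ s → b ≠ s → c ≠ s →
      (SimpleGraph.fromEdgeSet {z : Sym2 (Fin n) | s ∉ z ∧ w z ≠ 0}).IsAcyclic →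
      (Finset.univ.filter fun z : Sym2 (Fin n) => ¬ z.IsDiag ∧ s ∉ z ∧ w z ≠ 0).card ≤ N →
      ∀ (p₀ p p₁ : unitInterval), p₀ ≤ p → p ≤ p₁ →
      ((p₁ : ℝ) - (p : ℝ)) * sahiE3 (prodBernoulli (Function.update w s(s, x) p₀)) (openConn s a) (openConn s b) (openConn s c)
        + ((p : ℝ) - (p₀ : ℝ)) * sahiE3 (prodBernoulli (Function.update w s(s, x) p₁)) (openConn s a) (openConn s b) (openConn s c)
      ≤ ((p₁ : ℝ) - (p₀ : ℝ)) * sahiE3 (prodBernoulli (Function.update w s(s, x) p)) (openConn s a) (openConn s b) (openConn s c) from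
    H _ w x a b c hxs has hbs hcs hforest le_rfl p₀ p p₁ h01 h12
  intro N
  induction N using Nat.strong_induction_on with
  | _ N ih =>
  intro w x a b c hxs has hbs hcs hforest hN p₀ p p₁ h01 h12
  have IH : ∀ (w' : Sym2 (Fin n) → unitInterval) (x' : Fin n), x' ≠ s →
      (SimpleGraph.fromEdgeSet {z : Sym2 (Fin n) | s ∉ z ∧ w' z ≠ 0}).IsAcyclic →
      (Finset.univ.filter fun z : Sym2 (Fin n) => ¬ z.IsDiag ∧ s ∉ z ∧ w' z ≠ 0).card
        < (Finset.univ.filter fun z : Sym2 (Fin n) => ¬ z.IsDiag ∧ s ∉ z ∧ w z ≠ 0).card →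
      ∀ (r₀ r r₁ : unitInterval), r₀ ≤ r → r ≤ r₁ →
      ((r₁ : ℝ) - (r : ℝ)) * sahiE3 (prodBernoulli (Function.update w' s(s, x') r₀)) (openConn s a) (openConn s b) (openConn s c)
        + ((r : ℝ) - (r₀ : ℝ)) * sahiE3 (prodBernoulli (Function.update w' s(s, x') r₁)) (openConn s a) (openConn s b) (openConn s c)
      ≤ ((r₁ : ℝ) - (r₀ : ℝ)) * sahiE3 (prodBernoulli (Function.update w' s(s, x') r)) (openConn s a) (openConn s b) (openConn s c) :=
    fun w' x' hx's hf' hlt r₀ r r₁ h1 h2 =>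
      ih _ (lt_of_lt_of_le hlt hN) w' x' a b c hx's has hbs hcs hf' le_rfl r₀ r r₁ h1 h2
  have h01' : (p₀ : ℝ) ≤ p := h01
  have h12' : (p : ℝ) ≤ p₁ := h12
  set H := SimpleGraph.fromEdgeSet {z : Sym2 (Fin n) | s ∉ z ∧ w z ≠ 0} with hH
  -- the root is isolated in the environment; adjacency from positive weights
  have hHs : ∀ {t : Fin n}, t ≠ s → ¬ H.Reachable t s := by
    intro t hts h
    exact apexForest_root_not_mem w hts (∅ : Set (Sym2 (Fin n))) (by rwa [SimpleGraph.deleteEdges_empty])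
  have hadj_of : ∀ {y z : Fin n}, y ≠ s → z ≠ s → y ≠ z → w s(y, z) ≠ 0 → H.Adj y z := by
    intro y z hys hzs hyz hw
    rw [hH, SimpleGraph.fromEdgeSet_adj]
    refine ⟨⟨fun hmem => ?_, hw⟩, hyz⟩
    rcases Sym2.mem_iff.1 hmem with h | h
    · exact hys h.symm
    · exact hzs h.symm
  -- B′-forest in three-point form for a closed region `L` holding exactly one target slot (in `insert x L`)
  have single : ∀ (L : Set (Fin n)) (a' b' c' : Fin n), s ∉ L → x ∉ L →
      (∀ y z : Fin n, y ∈ L → z ∉ L → z ≠ s → z ≠ x → w s(y, z) = 0) →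
      a' ∈ (insert x L : Set (Fin n)) → b' ∉ L → b' ≠ s → c' ∉ L → c' ≠ s →
      ((p₁ : ℝ) - (p : ℝ)) * sahiE3 (prodBernoulli (Function.update w s(s, x) p₀)) (openConn s a') (openConn s b') (openConn s c')
        + ((p : ℝ) - (p₀ : ℝ)) * sahiE3 (prodBernoulli (Function.update w s(s, x) p₁)) (openConn s a') (openConn s b') (openConn s c')
      ≤ ((p₁ : ℝ) - (p₀ : ℝ)) * sahiE3 (prodBernoulli (Function.update w s(s, x) p)) (openConn s a') (openConn s b') (openConn s c') :=
    fun L a' b' c' hsL hxL hcr haL hbL hb's hcL hc's =>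
      rootPair_threePoint_of_apexForest w L hxs hsL hxL haL hbL hb's hcL hc's hcr hforest p₀ p p₁ h01 h12
  -- slot permutations
  have perm12 : ((p₁ : ℝ) - (p : ℝ)) * sahiE3 (prodBernoulli (Function.update w s(s, x) p₀)) (openConn s b) (openConn s a) (openConn s c)
        + ((p : ℝ) - (p₀ : ℝ)) * sahiE3 (prodBernoulli (Function.update w s(s, x) p₁)) (openConn s b) (openConn s a) (openConn s c)
      ≤ ((p₁ : ℝ) - (p₀ : ℝ)) * sahiE3 (prodBernoulli (Function.update w s(s, x) p)) (openConn s b) (openConn s a) (openConn s c) →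
      ((p₁ : ℝ) - (p : ℝ)) * sahiE3 (prodBernoulli (Function.update w s(s, x) p₀)) (openConn s a) (openConn s b) (openConn s c)
        + ((p : ℝ) - (p₀ : ℝ)) * sahiE3 (prodBernoulli (Function.update w s(s, x) p₁)) (openConn s a) (openConn s b) (openConn s c)
      ≤ ((p₁ : ℝ) - (p₀ : ℝ)) * sahiE3 (prodBernoulli (Function.update w s(s, x) p)) (openConn s a) (openConn s b) (openConn s c) := fun h => by
    simp only [sahiE3_comm₁₂ _ (openConn s b) (openConn s a) (openConn s c)] at h
    exact h
  have perm3 : ((p₁ : ℝ) - (p : ℝ)) * sahiE3 (prodBernoulli (Function.update w s(s, x) p₀)) (openConn s c) (openConn s a) (openConn s b)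
        + ((p : ℝ) - (p₀ : ℝ)) * sahiE3 (prodBernoulli (Function.update w s(s, x) p₁)) (openConn s c) (openConn s a) (openConn s b)
      ≤ ((p₁ : ℝ) - (p₀ : ℝ)) * sahiE3 (prodBernoulli (Function.update w s(s, x) p)) (openConn s c) (openConn s a) (openConn s b) →
      ((p₁ : ℝ) - (p : ℝ)) * sahiE3 (prodBernoulli (Function.update w s(s, x) p₀)) (openConn s a) (openConn s b) (openConn s c)
        + ((p : ℝ) - (p₀ : ℝ)) * sahiE3 (prodBernoulli (Function.update w s(s, x) p₁)) (openConn s a) (openConn s b) (openConn s c)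
      ≤ ((p₁ : ℝ) - (p₀ : ℝ)) * sahiE3 (prodBernoulli (Function.update w s(s, x) p)) (openConn s a) (openConn s b) (openConn s c) := fun h => by
    simp only [sahiE3_comm₁₂ _ (openConn s c) (openConn s a) (openConn s b),
      sahiE3_comm₂₃ _ (openConn s a) (openConn s c) (openConn s b)] at h
    exact h
  -- (b) a target AT `x`: B′ with `L = ∅`
  have hcr0 : ∀ y z : Fin n, y ∈ (∅ : Set (Fin n)) → z ∉ (∅ : Set (Fin n)) → z ≠ s → z ≠ x → w s(y, z) = 0 :=
    fun y z hy => absurd hy (Set.notMem_empty y)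
  by_cases hax : a = x
  · exact single ∅ a b c (Set.notMem_empty s) (Set.notMem_empty x) hcr0 (by rw [hax]; exact Set.mem_insert x ∅)
      (Set.notMem_empty b) hbs (Set.notMem_empty c) hcs
  by_cases hbx : b = x
  · exact perm12 (single ∅ b a c (Set.notMem_empty s) (Set.notMem_empty x) hcr0 (by rw [hbx]; exact Set.mem_insert x ∅)
      (Set.notMem_empty a) has (Set.notMem_empty c) hcs)
  by_cases hcx : c = x
  · exact perm3 (single ∅ c a b (Set.notMem_empty s) (Set.notMem_empty x) hcr0 (by rw [hcx]; exact Set.mem_insert x ∅)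
      (Set.notMem_empty a) has (Set.notMem_empty b) hbs)
  -- the two coarse regions: the tree of `x` minus `x`, and its far complement
  set T : Set (Fin n) := {z | H.Reachable x z ∧ z ≠ x} with hT
  set F : Set (Fin n) := {z | ¬ H.Reachable x z ∧ z ≠ s} with hF
  have hsT : s ∉ T := fun h => hHs hxs h.1
  have hxT : x ∉ T := fun h => h.2 rfl
  have hcrT : ∀ y z : Fin n, y ∈ T → z ∉ T → z ≠ s → z ≠ x → w s(y, z) = 0 := by
    intro y z hy hz hzs hzx
    by_contra hw
    have hys : y ≠ s := fun h => hsT (h ▸ hy)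
    have hyz : y ≠ z := fun h => hz (h ▸ hy)
    exact hz ⟨SimpleGraph.Reachable.trans hy.1 (hadj_of hys hzs hyz hw).reachable, hzx⟩
  have hsF : s ∉ F := fun h => h.2 rfl
  have hxF : x ∉ F := fun h => h.1 (SimpleGraph.Reachable.refl x)
  have hcrF : ∀ y z : Fin n, y ∈ F → z ∉ F → z ≠ s → z ≠ x → w s(y, z) = 0 := by
    intro y z hy hz hzs _
    by_contra hw
    have hRz : H.Reachable x z := by
      by_contra h
      exact hz ⟨h, hzs⟩
    have hyz : y ≠ z := fun h => hy.1 (h ▸ hRz)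
    exact hy.1 (hRz.trans (hadj_of hy.2 hzs hyz hw).symm.reachable)
  -- (far) no target in the tree of `x`
  by_cases hfar : ¬ H.Reachable x a ∧ ¬ H.Reachable x b ∧ ¬ H.Reachable x c
  · obtain ⟨hFa, hFb, hFc⟩ := hfar
    rw [incStar_rootPair_eq_of_far w hxs hFa hFb hFc p₀, incStar_rootPair_eq_of_far w hxs hFa hFb hFc p,
      incStar_rootPair_eq_of_far w hxs hFa hFb hFc p₁]
    have hid : ((p₁ : ℝ) - (p : ℝ)) * sahiE3 (prodBernoulli w) (openConn s a) (openConn s b) (openConn s c)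
        + ((p : ℝ) - (p₀ : ℝ)) * sahiE3 (prodBernoulli w) (openConn s a) (openConn s b) (openConn s c)
        = ((p₁ : ℝ) - (p₀ : ℝ)) * sahiE3 (prodBernoulli w) (openConn s a) (openConn s b) (openConn s c) := by ring
    exact hid.le
  -- (mixed) one or two targets outside the tree
  by_cases hall : H.Reachable x a ∧ H.Reachable x b ∧ H.Reachable x c
  swap
  · have memT : ∀ {t : Fin n}, H.Reachable x t → t ≠ x → t ∈ (insert x T : Set (Fin n)) :=
      fun ht htx => Set.mem_insert_of_mem x ⟨ht, htx⟩
    have nT : ∀ {t : Fin n}, ¬ H.Reachable x t → t ∉ T := fun ht h => ht h.1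
    have memF : ∀ {t : Fin n}, ¬ H.Reachable x t → t ≠ s → t ∈ (insert x F : Set (Fin n)) :=
      fun ht hts => Set.mem_insert_of_mem x ⟨ht, hts⟩
    have nF : ∀ {t : Fin n}, H.Reachable x t → t ∉ F := fun ht h => h.1 ht
    by_cases hRa : H.Reachable x a <;> by_cases hRb : H.Reachable x b <;> by_cases hRc : H.Reachable x c
    · exact absurd ⟨hRa, hRb, hRc⟩ hall
    · exact perm3 (single F c a b hsF hxF hcrF (memF hRc hcs) (nF hRa) has (nF hRb) hbs)
    · exact perm12 (single F b a c hsF hxF hcrF (memF hRb hbs) (nF hRa) has (nF hRc) hcs)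
    · exact single T a b c hsT hxT hcrT (memT hRa hax) (nT hRb) hbs (nT hRc) hcs
    · exact single F a b c hsF hxF hcrF (memF hRa has) (nF hRb) hbs (nF hRc) hcs
    · exact perm12 (single T b a c hsT hxT hcrT (memT hRb hbx) (nT hRa) has (nT hRc) hcs)
    · exact perm3 (single T c a b hsT hxT hcrT (memT hRc hcx) (nT hRa) has (nT hRb) hbs)
    · exact absurd ⟨hRa, hRb, hRc⟩ hfar
  -- all three targets in the tree of `x` (and none at `x`): look at the branch of `a`
  obtain ⟨hRa, hRb, hRc⟩ := hall
  obtain ⟨y, hxy, hya⟩ := reachable_firstStep hRa hax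
  have hyx : y ≠ x := hxy.ne'
  have hys : y ≠ s := by
    intro h
    have h1 := ((SimpleGraph.fromEdgeSet_adj _).1 hxy).1.1
    exact h1 (h ▸ Sym2.mem_mk_right x y)
  have hwxy : w s(x, y) ≠ 0 := ((SimpleGraph.fromEdgeSet_adj _).1 hxy).1.2
  set Ba : Set (Fin n) := {z | (H.deleteEdges {s(x, y)}).Reachable y z} with hBa
  have hyBa : y ∈ Ba := SimpleGraph.Reachable.refl y
  have hxBa : x ∉ Ba := fun h =>
    SimpleGraph.isBridge_iff.1 (SimpleGraph.isAcyclic_iff_forall_adj_isBridge.1 hforest hxy) (SimpleGraph.Reachable.symm h)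
  have hsBa : s ∉ Ba := fun h => apexForest_root_not_mem w hys {s(x, y)} h
  have hBaR : ∀ {z : Fin n}, z ∈ Ba → H.Reachable x z := fun hz =>
    hxy.reachable.trans (SimpleGraph.Reachable.mono (SimpleGraph.deleteEdges_le _) hz)
  -- the branch is closed under environment edges other than `s(x,y)`
  have hBa_cl : ∀ {z t : Fin n}, z ∈ Ba → H.Adj z t → s(z, t) ≠ s(x, y) → t ∈ Ba := by
    intro z t hz hadj hne
    exact SimpleGraph.Reachable.trans hz
      (SimpleGraph.Adj.reachable (SimpleGraph.deleteEdges_adj.2 ⟨hadj, fun h => hne (Set.mem_singleton_iff.1 h)⟩))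
  have hcrBa : ∀ y' z : Fin n, y' ∈ Ba → z ∉ Ba → z ≠ s → z ≠ x → w s(y', z) = 0 := by
    intro y' z hy' hz hzs hzx
    by_contra hw
    have hy's : y' ≠ s := fun h => hsBa (h ▸ hy')
    have hy'z : y' ≠ z := fun h => hz (h ▸ hy')
    refine hz (hBa_cl hy' (hadj_of hy's hzs hy'z hw) fun h => ?_)
    rw [Sym2.eq_iff] at h
    rcases h with ⟨h1, -⟩ | ⟨-, h2⟩
    · exact hxBa (h1 ▸ hy')
    · exact hzx h2
  -- the other branches at `x` (the tree minus `x` minus the branch of `a`)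
  set L₂ : Set (Fin n) := {z | H.Reachable x z ∧ z ≠ x ∧ z ∉ Ba} with hL₂
  have hsL₂ : s ∉ L₂ := fun h => hHs hxs h.1
  have hxL₂ : x ∉ L₂ := fun h => h.2.1 rfl
  have hcrL₂ : ∀ y' z : Fin n, y' ∈ L₂ → z ∉ L₂ → z ≠ s → z ≠ x → w s(y', z) = 0 := by
    intro y' z hy' hz hzs hzx
    by_contra hw
    have hy's : y' ≠ s := fun h => hsL₂ (h ▸ hy')
    have hy'z : y' ≠ z := fun h => hz (h ▸ hy')
    have hadj : H.Adj y' z := hadj_of hy's hzs hy'z hw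
    have hRz : H.Reachable x z := SimpleGraph.Reachable.trans hy'.1 hadj.reachable
    have hzBa : z ∈ Ba := by
      by_contra h
      exact hz ⟨hRz, hzx, h⟩
    refine hy'.2.2 (hBa_cl hzBa hadj.symm fun h => ?_)
    rw [Sym2.eq_iff] at h
    rcases h with ⟨h1, -⟩ | ⟨-, h2⟩
    · exact hxBa (h1 ▸ hzBa)
    · exact hy'.2.1 h2
  have nBa_L₂ : ∀ {t : Fin n}, H.Reachable x t → t ≠ x → t ∉ Ba → t ∈ (insert x L₂ : Set (Fin n)) :=
    fun ht htx htB => Set.mem_insert_of_mem x ⟨ht, htx, htB⟩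
  have nL₂ : ∀ {t : Fin n}, t ∈ Ba → t ∉ L₂ := fun ht h => h.2.2 ht
  by_cases hbB : b ∈ Ba <;> by_cases hcB : c ∈ Ba
  rotate_left
  · -- `b` in the branch of `a`, `c` elsewhere: single slot `c` in the other branches
    exact perm3 (single L₂ c a b hsL₂ hxL₂ hcrL₂ (nBa_L₂ hRc hcx hcB) (nL₂ hya) has (nL₂ hbB) hbs)
  · -- `c` in the branch of `a`, `b` elsewhere
    exact perm12 (single L₂ b a c hsL₂ hxL₂ hcrL₂ (nBa_L₂ hRb hbx hbB) (nL₂ hya) has (nL₂ hcB) hcs)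
  · -- `a` alone in its branch
    exact single Ba a b c hsBa hxBa hcrBa (Set.mem_insert_of_mem x hya) hbB hbs hcB hcs
  -- (c-ii) all three targets in ONE branch at `x`: blob-reduce the rest of the tree into the root pair at `y`
  set B₁ : Finset (Fin n) := Finset.univ.filter fun z => H.Reachable x z ∧ z ∉ Ba with hB₁
  have memB₁ : ∀ z : Fin n, z ∈ B₁ ↔ H.Reachable x z ∧ z ∉ Ba := fun z => by
    rw [hB₁, Finset.mem_filter]
    exact ⟨fun h => h.2, fun h => ⟨Finset.mem_univ _, h⟩⟩
  have hsB₁ : s ∉ B₁ := fun h => hHs hxs ((memB₁ s).1 h).1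
  have hyB₁ : y ∉ B₁ := fun h => ((memB₁ y).1 h).2 hyBa
  have hxB₁ : x ∈ B₁ := (memB₁ x).2 ⟨SimpleGraph.Reachable.refl x, hxBa⟩
  have haB₁ : a ∉ B₁ := fun h => ((memB₁ a).1 h).2 hya
  have hbB₁ : b ∉ B₁ := fun h => ((memB₁ b).1 h).2 hbB
  have hcB₁ : c ∉ B₁ := fun h => ((memB₁ c).1 h).2 hcB
  have hwB₁ : ∀ x' ∈ B₁, ∀ z, z ∉ B₁ → z ≠ s → z ≠ y → w s(x', z) = 0 := by
    intro x' hx' z hzB₁ hzs hzy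
    obtain ⟨hRx', hx'Ba⟩ := (memB₁ x').1 hx'
    by_contra hw
    have hx's : x' ≠ s := fun h => hHs hxs (h ▸ hRx')
    have hx'z : x' ≠ z := fun h => hzB₁ (h ▸ hx')
    have hadj : H.Adj x' z := hadj_of hx's hzs hx'z hw
    have hzBa : z ∈ Ba := by
      by_contra h
      exact hzB₁ ((memB₁ z).2 ⟨hRx'.trans hadj.reachable, h⟩)
    refine hx'Ba (hBa_cl hzBa hadj.symm fun h => ?_)
    rw [Sym2.eq_iff] at h
    rcases h with ⟨h1, -⟩ | ⟨h1, -⟩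
    · exact hxBa (h1 ▸ hzBa)
    · exact hzy h1
  obtain ⟨θ₀, θ₁, hθ, hq⟩ := incStar_rootPair_blob_transfer w B₁ hsB₁ hyB₁ hys.symm hxB₁ hwB₁ haB₁ hbB₁ hcB₁
  obtain ⟨r₀, hr₀, E0⟩ := hq p₀
  obtain ⟨r, hr, E⟩ := hq p
  obtain ⟨r₁, hr₁, E1⟩ := hq p₁
  rw [E0, E, E1]
  -- the reduced weight: an apex-forest with fewer environment pairs (`s(x,y)` is switched off)
  set W : Sym2 (Fin n) → unitInterval := fun z => if (∃ x' ∈ B₁, x' ∈ z) then 0 else w z with hW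
  have hWapp : ∀ z : Sym2 (Fin n), W z = if (∃ x' ∈ B₁, x' ∈ z) then 0 else w z := fun z => by rw [hW]
  have hWz : ∀ z : Sym2 (Fin n), W z ≠ 0 → w z ≠ 0 := by
    intro z hz
    by_cases h : ∃ x' ∈ B₁, x' ∈ z
    · rw [hWapp z, if_pos h] at hz
      exact absurd rfl hz
    · rwa [hWapp z, if_neg h] at hz
  have hforestW : (SimpleGraph.fromEdgeSet {z : Sym2 (Fin n) | s ∉ z ∧ W z ≠ 0}).IsAcyclic := by
    refine hforest.anti fun u v huv => ?_
    rw [SimpleGraph.fromEdgeSet_adj] at huv ⊢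
    exact ⟨⟨huv.1.1, hWz _ huv.1.2⟩, huv.2⟩
  have hlt : (Finset.univ.filter fun z : Sym2 (Fin n) => ¬ z.IsDiag ∧ s ∉ z ∧ W z ≠ 0).card
      < (Finset.univ.filter fun z : Sym2 (Fin n) => ¬ z.IsDiag ∧ s ∉ z ∧ w z ≠ 0).card := by
    apply Finset.card_lt_card
    refine ⟨fun z hz => ?_, fun hsub => ?_⟩
    · obtain ⟨-, hd, hsz, hWz'⟩ := Finset.mem_filter.1 hz
      exact Finset.mem_filter.2 ⟨Finset.mem_univ _, hd, hsz, hWz z hWz'⟩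
    · have hmem : s(x, y) ∈ (Finset.univ.filter fun z : Sym2 (Fin n) => ¬ z.IsDiag ∧ s ∉ z ∧ w z ≠ 0) :=
        Finset.mem_filter.2 ⟨Finset.mem_univ _, by rw [Sym2.mk_isDiag_iff]; exact hxy.ne,
          ((SimpleGraph.fromEdgeSet_adj _).1 hxy).1.1, hwxy⟩
      have h := (Finset.mem_filter.1 (hsub hmem)).2.2.2
      exact h (by rw [hWapp]; exact if_pos ⟨x, hxB₁, Sym2.mem_mk_left x y⟩)
  -- order of the new abscissae
  have hk : 0 ≤ θ₁ - θ₀ := sub_nonneg.2 hθ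
  have h01r : r₀ ≤ r := by
    have h1 : (0 : ℝ) ≤ ((p : ℝ) - p₀) * (θ₁ - θ₀) := mul_nonneg (sub_nonneg.2 h01') hk
    have h2 : (r₀ : ℝ) ≤ r := by rw [hr₀, hr]; linarith
    exact_mod_cast h2
  have h12r : r ≤ r₁ := by
    have h1 : (0 : ℝ) ≤ ((p₁ : ℝ) - p) * (θ₁ - θ₀) := mul_nonneg (sub_nonneg.2 h12') hk
    have h2 : (r : ℝ) ≤ r₁ := by rw [hr, hr₁]; linarith
    exact_mod_cast h2
  have key := IH W y hys hforestW hlt r₀ r r₁ h01r h12r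
  -- transfer along the affine reparametrisation `q ↦ θ₀ + q (θ₁ − θ₀)`
  have e0 : (r₀ : ℝ) = θ₀ + (p₀ : ℝ) * (θ₁ - θ₀) := by rw [hr₀]; ring
  have e : (r : ℝ) = θ₀ + (p : ℝ) * (θ₁ - θ₀) := by rw [hr]; ring
  have e1 : (r₁ : ℝ) = θ₀ + (p₁ : ℝ) * (θ₁ - θ₀) := by rw [hr₁]; ring
  refine threePoint_transfer_real (θ := θ₀) hk ?_ fun hk0 => ?_
  · rw [← e0, ← e, ← e1]
    exact key
  · have hθ' : θ₁ = θ₀ := by linarith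
    have h1 : r₀ = r := Subtype.ext (by rw [hr₀, hr, hθ']; ring)
    have h2 : r₁ = r := Subtype.ext (by rw [hr₁, hr, hθ']; ring)
    rw [h1, h2]
    exact ⟨rfl, rfl⟩

end IncStar

end Summit.CriticalPhenomena.PercolationContinuityZ3.Theorems
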